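import Literature.NumberTheory.EllipticCurves.IwasawaSelmerControl
import Literature.NumberTheory.EllipticCurves.IsogenySelmerInfty
import Literature.NumberTheory.DiophantineGeometry.LocalReductionProofs
import Literature.NumberTheory.EllipticCurves.LFunctionSmulProofs
import HarnessLib

/-!
# Route `ByReductionTypeAtTwo`, item `OrdKatoHalfAtTwo` (stmt-BirchSwinnertonDyer-19271), TOWER road: the Selmer tower
# `H¹(K_n, E[p^∞]) ⊇ Sel_{p^∞}(E/K_n) → Sel_{p^∞}(E/K_∞) ⊆ H¹(K_∞, E[p^∞])` does not depend on the Weierstrass model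
# (dictionaries along `C • W`; part 1 of 2 — part 2 `…GoodOrdTowerControlModel.lean` transports Mazur's control theorem)

HONEST FRAMING (cell `bsd-2adic`, run/shared/lean/pub/bsd-2adic/, seat `bsd-2adic-tower-1` GEN 21, HUMAN RULINGS
D-0036 / D-0054 / D-0074): theorems only (no definition, no named fact, no `sorry`, axioms the standard trio); closes no
route item by itself; nothing booked; BSD is not proved by any of this. Follow-on (β) of `…GoodOrdTowerControl{,P,AllP}.lean`.

WHAT IT PROVES. The named predicates `WeierstrassCurve.selmer_control κ` (Mazur's control theorem, Greenberg LNM 1716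
Thm. 1.2) and `WeierstrassCurve.Greenberg1999_kerG_bounded κ` (Lemma 3.5) are statements about the tower
`H¹(K_n, E[p^∞]) ⊇ Sel_{p^∞}(E/K_n) → Sel_{p^∞}(E/K_∞) ⊆ H¹(K_∞, E[p^∞])` of ONE Weierstrass model `W`. A change of
variables `C` over `K` induces, for EVERY subgroup `H ≤ Γ_K`, an isomorphism `H¹(H, W[p^∞]) ≃ H¹(H, (C • W)[p^∞])`
(the tree's `IsogenySelmerInfty.h1Map` of the substitution `geomPointsEquiv W C` and of its inverse) which commutes
with restriction, with the conjugation action of `Γ_K` and with the local conditions; hence every group in the two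
predicates for `C • W` is isomorphic to the corresponding group for `W`, and the predicates (whose hypotheses — good
reduction and the unit-root condition at `v ∣ p` — are model-independent too) are EQUIVALENT for `W` and `C • W`.
Since every elliptic curve over `ℚ` has a globally minimal model (`hasGlobalMinimalModel_rat_holds`, tree theorem)
and the control chain is proved for globally minimal models at every prime (`GoodOrdTower.selmer_control_all`,
p624991), Mazur's control theorem holds for EVERY `W : WeierstrassCurve ℚ`, every prime `p`, every
`κ : ZpExtension ℚ p` — exactly the binder shape
`∀ (W : WeierstrassCurve ℚ) {p : ℕ} [Fact p.Prime] (κ : ZpExtension ℚ p), W.selmer_control κ` consumed by the Literature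
reductions `Greenberg1999_coinvariantsRank_eq_selmerCorank_rat_of_selmer_control` /
`SelmerDualData.isTorsion_of_finite_selmerGroup_of_kerG_bounded`.

* §1 the substitution map `h1Map p H (geomPointsEquiv W C)` is an additive equivalence `H¹(H, W[p^∞]) ≃+ H¹(H, (C • W)[p^∞])`
  (`exists_h1EquivOfSmul`) commuting with restriction, conjugation and the Selmer conditions.
* §2 the tower dictionaries (`selmerLayer`, `ker layerToInfty`, `selmerInfty`, `layerInvariants`, the image of the
  layer, `selmerInftyPreimage`).
* §3 bookkeeping: finiteness / cardinality of matched subgroups and `addSubgroupOf` subquotients along `≃+`.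
* §4 the hypotheses (good reduction, unit-root condition at `v`) are model-independent (`hasUnitRootAt_smul_iff`).
* (part 2) `selmer_control_smul_iff`, `Greenberg1999_kerG_bounded_smul_iff`; `selmer_control` for EVERY `W : WeierstrassCurve ℚ`.

References: Mazur, Invent. Math. 18 (1972) §6; Greenberg, LNM 1716 (1999) Thm 1.2, §3; Silverman, *AEC* VII.1.3(b), VIII.8, X.§4.
-/

set_option autoImplicit false
-- the Theorems namespace of this sub repeats the summit name by design (D-0017 nested layout: Summit.<S>.<Sub>)
set_option linter.dupNamespace false

noncomputable section

open scoped Classical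

universe u

namespace Summit.BirchSwinnertonDyer.BirchSwinnertonDyer.Theorems.GoodOrdTower

open NumberField IsDedekindDomain Field Literature.NumberTheory.EllipticCurves
  Literature.NumberTheory.EllipticCurves.IsogenySelmerInfty WeierstrassCurve

/-! ## §1. `H¹(H, W[p^∞]) ≃ H¹(H, (C • W)[p^∞])` for every subgroup `H ≤ Γ_K` -/

section H1Equiv

variable {K : Type u} [Field K] (W : WeierstrassCurve K) (p : ℕ) (C : VariableChange K)
  (H : Subgroup (absoluteGaloisGroup K))

/-- `H¹(H, ·)` of the inverse substitution is a left inverse of `H¹(H, ·)` of the substitution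
`W(K̄) ≃ (C • W)(K̄)` (composite `[1]`). [cite: SilvermanAEC2009, X.§4] -/
theorem h1Map_symm_h1Map (c : W.subgroupH1 p H) :
    h1Map p H (geomPointsEquiv W C).symm.toAddMonoidHom (geomPointsEquiv_symm_smul W C)
      (h1Map p H (geomPointsEquiv W C).toAddMonoidHom (geomPointsEquiv_smul W C) c) = c := by
  have h := h1Map_h1Map_of_comp_eq_nsmul p H (geomPointsEquiv W C).toAddMonoidHom (geomPointsEquiv_smul W C)
    (geomPointsEquiv W C).symm.toAddMonoidHom (geomPointsEquiv_symm_smul W C) (n := 1) (fun P ↦ by simp) c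
  rwa [one_smul] at h

/-- … and a right inverse. [cite: SilvermanAEC2009, X.§4] -/
theorem h1Map_h1Map_symm (c : (C • W).subgroupH1 p H) :
    h1Map p H (geomPointsEquiv W C).toAddMonoidHom (geomPointsEquiv_smul W C)
      (h1Map p H (geomPointsEquiv W C).symm.toAddMonoidHom (geomPointsEquiv_symm_smul W C) c) = c := by
  have h := h1Map_h1Map_of_comp_eq_nsmul p H (geomPointsEquiv W C).symm.toAddMonoidHom
    (geomPointsEquiv_symm_smul W C) (geomPointsEquiv W C).toAddMonoidHom (geomPointsEquiv_smul W C) (n := 1)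
    (fun P ↦ by simp) c
  rwa [one_smul] at h

/-- **`H¹(H, W[p^∞]) ≃+ H¹(H, (C • W)[p^∞])`** for every subgroup `H ≤ Γ_K` (`H = Gal(K̄/L)`: the group
`H¹(L, E[p^∞])` is attached to `E/K`, not to a Weierstrass model): `H¹(H, ·)` of the substitution is an additive
equivalence. Stated as an existence theorem (this file declares no definitions). [cite: SilvermanAEC2009, X.§4] -/
theorem exists_h1EquivOfSmul : ∃ e : W.subgroupH1 p H ≃+ (C • W).subgroupH1 p H,
    ∀ c, e c = h1Map p H (geomPointsEquiv W C).toAddMonoidHom (geomPointsEquiv_smul W C) c :=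
  ⟨{ toFun := h1Map p H (geomPointsEquiv W C).toAddMonoidHom (geomPointsEquiv_smul W C)
     invFun := h1Map p H (geomPointsEquiv W C).symm.toAddMonoidHom (geomPointsEquiv_symm_smul W C)
     left_inv := h1Map_symm_h1Map W p C H
     right_inv := h1Map_h1Map_symm W p C H
     map_add' := map_add _ }, fun _ ↦ rfl⟩

/-- `H¹(H, ·)` of the substitution is injective. [cite: SilvermanAEC2009, X.§4] -/
theorem h1Map_smul_injective :
    Function.Injective (h1Map p H (geomPointsEquiv W C).toAddMonoidHom (geomPointsEquiv_smul W C)) :=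
  Function.LeftInverse.injective (h1Map_symm_h1Map W p C H)

/-- **The substitution map commutes with restriction** `H¹(H', ·) → H¹(H, ·)` for `H ≤ H'`.
[cite: SerreGaloisCohomology1997, I.§2.4] -/
theorem resOfLe_h1Map_smul {H H' : Subgroup (absoluteGaloisGroup K)} (hle : H ≤ H') (c : W.subgroupH1 p H') :
    (C • W).resOfLe p hle (h1Map p H' (geomPointsEquiv W C).toAddMonoidHom (geomPointsEquiv_smul W C) c) =
      h1Map p H (geomPointsEquiv W C).toAddMonoidHom (geomPointsEquiv_smul W C) (W.resOfLe p hle c) := by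
  change (((C • W).resOfLe p hle).comp (h1Map p H' (geomPointsEquiv W C).toAddMonoidHom
      (geomPointsEquiv_smul W C))) c =
    ((h1Map p H (geomPointsEquiv W C).toAddMonoidHom (geomPointsEquiv_smul W C)).comp (W.resOfLe p hle)) c
  unfold h1Map WeierstrassCurve.resOfLe Literature.NumberTheory.EllipticCurves.resOfLe
  rw [resH1Hom_comp, resH1Hom_comp]
  exact congrArg (fun F : W.subgroupH1 p H' →+ (C • W).subgroupH1 p H ↦ F c)
    (resH1Hom_congr (ContinuousMonoidHom.ext fun _ ↦ rfl) (AddMonoidHom.ext fun _ ↦ rfl) _ _)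

variable [NumberField K] [H.Normal]

/-- **The substitution map identifies the Selmer groups** `Sel_{p^∞}(W/L) ≃ Sel_{p^∞}(C • W/L)`, `L = K̄^H`
(local conditions respected in both directions: `h1Map_mem_selmerGroupOver` for the substitution and its inverse).
[cite: SilvermanAEC2009, X.§4] -/
theorem h1Map_smul_mem_selmerGroupOver_iff (c : W.subgroupH1 p H) :
    h1Map p H (geomPointsEquiv W C).toAddMonoidHom (geomPointsEquiv_smul W C) c ∈ (C • W).selmerGroupOver p H ↔
      c ∈ W.selmerGroupOver p H := by
  refine ⟨fun hc ↦ ?_, fun hc ↦ h1Map_mem_selmerGroupOver p H _ (geomPointsEquiv_smul W C)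
    (hasLocalPointsMaps_geomPointsEquiv W C) hc⟩
  have h := h1Map_mem_selmerGroupOver p H _ (geomPointsEquiv_symm_smul W C)
    (hasLocalPointsMaps_geomPointsEquiv_symm W C) hc
  rwa [h1Map_symm_h1Map] at h

end H1Equiv

/-! ## §2. The tower dictionaries along `C • W` -/

section Tower

variable {K : Type u} [Field K] [NumberField K] (W : WeierstrassCurve K) {p : ℕ} [Fact p.Prime]
  (κ : ZpExtension K p) (C : VariableChange K)

omit [NumberField K] in
/-- The substitution maps commute with the restriction maps `h_n : H¹(K_n, ·) → H¹(K_∞, ·)` of the tower.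
[cite: GreenbergLNM1716, §3 p. 85] -/
theorem layerToInfty_h1Map_smul (n : ℕ) (x : W.subgroupH1 p (κ.layerSubgroup n)) :
    (C • W).layerToInfty κ n (h1Map p (κ.layerSubgroup n) (geomPointsEquiv W C).toAddMonoidHom
        (geomPointsEquiv_smul W C) x) =
      h1Map p κ.kerSubgroup (geomPointsEquiv W C).toAddMonoidHom (geomPointsEquiv_smul W C) (W.layerToInfty κ n x) :=
  resOfLe_h1Map_smul W p C (κ.kerSubgroup_le_layerSubgroup n) x

/-- Dictionary: `Sel_{p^∞}(·/K_n)`. [cite: SilvermanAEC2009, X.§4] -/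
theorem h1Map_smul_mem_selmerLayer_iff (n : ℕ) (x : W.subgroupH1 p (κ.layerSubgroup n)) :
    h1Map p (κ.layerSubgroup n) (geomPointsEquiv W C).toAddMonoidHom (geomPointsEquiv_smul W C) x ∈
        (C • W).selmerLayer κ n ↔ x ∈ W.selmerLayer κ n :=
  h1Map_smul_mem_selmerGroupOver_iff W p C (κ.layerSubgroup n) x

/-- Dictionary: `Sel_{p^∞}(·/K_∞)`. [cite: SilvermanAEC2009, X.§4] -/
theorem h1Map_smul_mem_selmerInfty_iff (y : W.subgroupH1 p κ.kerSubgroup) :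
    h1Map p κ.kerSubgroup (geomPointsEquiv W C).toAddMonoidHom (geomPointsEquiv_smul W C) y ∈ (C • W).selmerInfty κ ↔
      y ∈ W.selmerInfty κ :=
  h1Map_smul_mem_selmerGroupOver_iff W p C κ.kerSubgroup y

omit [NumberField K] in
/-- Dictionary: `ker h_n`. [cite: GreenbergLNM1716, §3 Lemma 3.1] -/
theorem h1Map_smul_mem_ker_layerToInfty_iff (n : ℕ) (x : W.subgroupH1 p (κ.layerSubgroup n)) :
    h1Map p (κ.layerSubgroup n) (geomPointsEquiv W C).toAddMonoidHom (geomPointsEquiv_smul W C) x ∈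
        ((C • W).layerToInfty κ n).ker ↔ x ∈ (W.layerToInfty κ n).ker := by
  rw [AddMonoidHom.mem_ker, AddMonoidHom.mem_ker, layerToInfty_h1Map_smul,
    ← (h1Map_smul_injective W p C κ.kerSubgroup).eq_iff, map_zero]

omit [NumberField K] in
/-- Dictionary: the invariants `H¹(K_∞, ·)^{Γ_n}` (the substitution commutes with conjugation, `h1Map_conjH1`).
[cite: GreenbergLNM1716, §3 Lemma 3.2] -/
theorem h1Map_smul_mem_layerInvariants_iff (n : ℕ) (y : W.subgroupH1 p κ.kerSubgroup) :
    h1Map p κ.kerSubgroup (geomPointsEquiv W C).toAddMonoidHom (geomPointsEquiv_smul W C) y ∈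
        (C • W).layerInvariants κ n ↔ y ∈ W.layerInvariants κ n := by
  simp only [mem_layerInvariants_iff, ← h1Map_conjH1, (h1Map_smul_injective W p C κ.kerSubgroup).eq_iff]

/-- Dictionary: the image `h_n(Sel_{p^∞}(·/K_n))`. [cite: GreenbergLNM1716, Thm 1.2] -/
theorem h1Map_smul_mem_map_selmerLayer_iff (n : ℕ) (y : W.subgroupH1 p κ.kerSubgroup) :
    h1Map p κ.kerSubgroup (geomPointsEquiv W C).toAddMonoidHom (geomPointsEquiv_smul W C) y ∈
        ((C • W).selmerLayer κ n).map ((C • W).layerToInfty κ n) ↔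
      y ∈ (W.selmerLayer κ n).map (W.layerToInfty κ n) := by
  constructor
  · rintro ⟨x', hx', hy⟩
    refine ⟨h1Map p (κ.layerSubgroup n) (geomPointsEquiv W C).symm.toAddMonoidHom (geomPointsEquiv_symm_smul W C) x',
      (h1Map_smul_mem_selmerLayer_iff W κ C n _).mp (by rw [h1Map_h1Map_symm]; exact hx'), ?_⟩
    apply h1Map_smul_injective W p C κ.kerSubgroup
    rw [← layerToInfty_h1Map_smul, h1Map_h1Map_symm, hy]
  · rintro ⟨x, hx, rfl⟩
    exact ⟨_, (h1Map_smul_mem_selmerLayer_iff W κ C n x).mpr hx, layerToInfty_h1Map_smul W κ C n x⟩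

/-- Dictionary: `A_n = h_n⁻¹(Sel_∞)`. [cite: GreenbergLNM1716, §3 p. 85] -/
theorem h1Map_smul_mem_selmerInftyPreimage_iff (n : ℕ) (x : W.subgroupH1 p (κ.layerSubgroup n)) :
    h1Map p (κ.layerSubgroup n) (geomPointsEquiv W C).toAddMonoidHom (geomPointsEquiv_smul W C) x ∈
        (C • W).selmerInftyPreimage κ n ↔ x ∈ W.selmerInftyPreimage κ n := by
  rw [mem_selmerInftyPreimage_iff, mem_selmerInftyPreimage_iff, layerToInfty_h1Map_smul,
    h1Map_smul_mem_selmerInfty_iff]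

end Tower

/-! ## §3. Transport of subgroups and subquotients along an additive equivalence (bookkeeping) -/

section Transport

variable {G G' : Type*} [AddCommGroup G] [AddCommGroup G'] (e : G ≃+ G')

/-- Finiteness and cardinality of subgroups matched by an additive equivalence agree. [folklore] -/
theorem finite_iff_and_natCard_eq_of_iff {B : AddSubgroup G} {B' : AddSubgroup G'} (hB : ∀ x, e x ∈ B' ↔ x ∈ B) :
    (Finite B' ↔ Finite B) ∧ Nat.card B' = Nat.card B := by
  let f : B → B' := fun x ↦ ⟨e x, (hB x).mpr x.2⟩
  have hf : Function.Bijective f := by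
    refine ⟨fun x y h ↦ Subtype.ext (e.injective (congrArg Subtype.val h)), fun y ↦ ⟨⟨e.symm y, (hB _).mp ?_⟩, ?_⟩⟩
    · rw [AddEquiv.apply_symm_apply]; exact y.2
    · exact Subtype.ext (e.apply_symm_apply y)
  exact ⟨(Equiv.finite_iff (Equiv.ofBijective f hf)).symm, (Nat.card_congr (Equiv.ofBijective f hf)).symm⟩

/-- Finiteness and cardinality of the `addSubgroupOf` subquotients `↥B ⧸ (A ⊓ B)` matched by an additive equivalence
agree (`QuotientAddGroup.congr` along the restricted equivalence `↥B ≃+ ↥B'`). [folklore] -/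
theorem finite_iff_and_natCard_quotient_eq_of_iff {A B : AddSubgroup G} {A' B' : AddSubgroup G'}
    (hA : ∀ x, e x ∈ A' ↔ x ∈ A) (hB : ∀ x, e x ∈ B' ↔ x ∈ B) :
    (Finite (B' ⧸ A'.addSubgroupOf B') ↔ Finite (B ⧸ A.addSubgroupOf B)) ∧
      Nat.card (B' ⧸ A'.addSubgroupOf B') = Nat.card (B ⧸ A.addSubgroupOf B) := by
  let f : B →+ B' := (e.toAddMonoidHom.comp B.subtype).codRestrict B' fun x ↦ (hB x).mpr x.2
  have hf : Function.Bijective f := by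
    refine ⟨fun x y h ↦ Subtype.ext (e.injective (congrArg Subtype.val h)), fun y ↦ ⟨⟨e.symm y, (hB _).mp ?_⟩, ?_⟩⟩
    · rw [AddEquiv.apply_symm_apply]; exact y.2
    · exact Subtype.ext (e.apply_symm_apply y)
  let eB : B ≃+ B' := AddEquiv.ofBijective f hf
  have heB : ∀ x : B, ((eB x : B') : G') = e x := fun _ ↦ rfl
  have hmap : (A.addSubgroupOf B).map (eB : B →+ B') = A'.addSubgroupOf B' := by
    ext y
    simp only [AddSubgroup.mem_map, AddSubgroup.mem_addSubgroupOf, AddMonoidHom.coe_coe]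
    constructor
    · rintro ⟨x, hx, rfl⟩
      rw [heB]; exact (hA x).mpr hx
    · intro hy
      refine ⟨eB.symm y, ?_, AddEquiv.apply_symm_apply _ _⟩
      have : e (eB.symm y : G) = (y : G') := by rw [← heB, AddEquiv.apply_symm_apply]
      rw [← hA, this]; exact hy
  let q := QuotientAddGroup.congr (A.addSubgroupOf B) (A'.addSubgroupOf B') eB hmap
  exact ⟨(Equiv.finite_iff q.toEquiv).symm, (Nat.card_congr q.toEquiv).symm⟩

end Transport

/-! ## §4. The hypotheses at `v ∣ p` are model-independent -/

section Hypotheses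

variable {K : Type*} [Field K] [NumberField K] (v : HeightOneSpectrum (𝓞 K)) (W : WeierstrassCurve K)
  (C : VariableChange K)

/-- **The unit-root (ordinarity) condition at `v` does not depend on the model**: the chosen local minimal models of
`W` and `C • W` at `v` are `K_v`-isomorphic minimal equations (`exists_localMinimalModel_smul_eq`), so their
reductions have the same number of points (Silverman VII.1.3(b); `natCard_point_reduction_eq_of_isMinimal_of_eq_smul`).
[cite: SilvermanAEC2009, VII.1 Prop. 1.3(b) and VII.2] -/
theorem hasUnitRootAt_smul_iff [W.IsElliptic] : (C • W).HasUnitRootAt v ↔ W.HasUnitRootAt v := by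
  obtain ⟨D, hD⟩ := W.exists_localMinimalModel_smul_eq v C
  haveI := W.isElliptic_localMinimalModel v
  have hΔ : (W.localMinimalModel v).Δ ≠ 0 := (W.localMinimalModel v).isUnit_Δ.ne_zero
  unfold WeierstrassCurve.HasUnitRootAt
  rw [natCard_point_reduction_eq_of_isMinimal_of_eq_smul (v.adicCompletionIntegers K) hD hΔ]

/-- The hypothesis of `selmer_control` / `Greenberg1999_kerG_bounded` (good reduction and the unit-root condition
at every `v ∣ p`) does not depend on the model. [cite: SilvermanAEC2009, VII.5 Prop. 5.1 and VII.1 Prop. 1.3(b)] -/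
theorem hasGoodReductionAt_and_hasUnitRootAt_smul_iff [W.IsElliptic] :
    ((C • W).HasGoodReductionAt v ∧ (C • W).HasUnitRootAt v) ↔ (W.HasGoodReductionAt v ∧ W.HasUnitRootAt v) := by
  rw [W.hasGoodReductionAt_smul_iff_holds v C, hasUnitRootAt_smul_iff v W C]

end Hypotheses

end Summit.BirchSwinnertonDyer.BirchSwinnertonDyer.Theorems.GoodOrdTower

end
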